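import Mathlib
import Summits.Ventures.Crystal3D.Theorems.StickyWulffConstantTextureLiminfTentTables
import HarnessLib

/-!
# The tent certificate for fcc grains — DEFINITIONS of the continuum half (eng g8)

Route `StickyWulffConstant` of `Summits/Ventures/Crystal3D` (cell `crystal3d-full`), support toward the
crux `TextureLiminf` (stmt-Ventures-19483), line TexShadow v6.1 (planner cf-p1 gen 19), FREE half:
`stub_barlowFreeCertificate` is the ∃-LEVEL FORM of the TENT CERTIFICATE (lit §26, ROUTE.md §71–72).
This file fixes, in the coefficient model of `…TextureLiminfTentTables.lean` (sites `Fin 3 → ℤ`, positions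
`(√2)⁻¹ • intVec (fccPoint n)`, cubic frame, nearest-neighbour distance `1`), the CLOSED-FORM objects the
continuum half works with — in "`D₃` units" `y = √2 • x`:

* `cubo y = max (|y₀|, |y₁|, |y₂|, (|y₀|+|y₁|+|y₂|)/2)` — the gauge of the cuboctahedron spanned by the
  twelve nearest neighbours (the closed vertex star of a lattice point in the tet–oct complex coned at
  the octahedron centres); `hatL y = max 0 (1 − cubo y)` — the piecewise-affine HAT FUNCTION of a
  lattice vertex; `hatH y = max 0 (1 − ‖y‖₁)` — the hat function of an octahedron centre (a hole
  `fccPoint p + (1,0,0)`, `holeZ p`);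
* `tent X` — the continuous piecewise-affine interpolant of `1_X` on the sites and of the centre rule
  `twoAlpha / 2` on the octahedron centres: `Σ_{w ∈ X} hatL(√2x − w) + Σ_p (twoAlpha/2)·hatH(√2x − holeZ p)`;
* the CELLS as chambers of the arrangement `{⟪a, y⟫ ∈ 2ℤ : a ∈ (1,1,1),(1,1,−1),(1,−1,1),(−1,1,1)} ∪
  {y_i ∈ ℤ}` (its chambers are exactly the tetrahedra and the octahedron corners of the coned tet–oct
  complex): `normal4` the four `(111)` normals, `chamberH k m` the fourteen constraints
  `k_i < y_i < k_i + 1`, `2m_j < ⟪a_j, y⟫ < 2m_j + 2` written as an `H`-representation in `x`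
  (normals `√2 • e_i`, `√2 • a_j`, integer levels) — redundant constraints are harmless for the
  continuum toolkit (`Literature/Analysis/Convexity/AnisotropicPerimeterLevel*`), distinct labels give
  disjoint chambers for free — `cellOf k m` the open chamber, `closedChamber k m` its fourteen
  non-strict inequalities; the labels of the three kinds of cells anchored at a site `p`:
  `labelUp p`, `labelDn p`, `labelCorner p s`.

WHAT THIS IS NOT: any statement or proof (see `…TentHat*.lean`); F-C1 not moved.
-/

noncomputable section

namespace Summit.Ventures.Crystal3D.TentCertificate

open Finset Summit.Ventures.Crystal3D MeasureTheory
open Literature.Geometry.DiscreteGeometry (intVec)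
open scoped RealInnerProductSpace

/-- Gauge of the cuboctahedron `conv{(±1,±1,0), …}`: `max (‖y‖_∞, ‖y‖₁ / 2)`. -/
def cubo (y : EuclideanSpace ℝ (Fin 3)) : ℝ := max (max (max |y 0| |y 1|) |y 2|) ((|y 0| + |y 1| + |y 2|) / 2)

/-- Hat function of a lattice vertex of the coned tet–oct complex (`D₃` units): `max 0 (1 − cubo y)`. -/
def hatL (y : EuclideanSpace ℝ (Fin 3)) : ℝ := max 0 (1 - cubo y)

/-- Hat function of an octahedron centre (`D₃` units): `max 0 (1 − ‖y‖₁)`. -/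
def hatH (y : EuclideanSpace ℝ (Fin 3)) : ℝ := max 0 (1 - (|y 0| + |y 1| + |y 2|))

/-- The centre (octahedral hole) of the octahedron `O(p)`, in `D₃` coordinates: `fccPoint p + (1,0,0)`. -/
def holeZ (p : Site) : Site := fccPoint p + ![1, 0, 0]

/-- **The tent** `f_X : ℝ³ → ℝ` of a finite site set `X`: the continuous piecewise-affine function on
the coned tet–oct complex with `f_X = 1_X` at the sites and `f_X = twoAlpha / 2 ∈ {0, ½, 1}` at the
octahedron centres (centre rule: `≤ 1 / 2–4 / ≥ 5` occupied vertices), written in closed form as a sum of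
hat functions. -/
def tent (X : Finset Site) (x : EuclideanSpace ℝ (Fin 3)) : ℝ :=
  ∑ w ∈ X, hatL (Real.sqrt 2 • x - intVec (fccPoint w)) +
    ∑ p ∈ idx X, ((twoAlpha (patO X p) : ℝ) / 2) * hatH (Real.sqrt 2 • x - intVec (holeZ p))

/-- The four `(111)`-type normals of the tet–oct arrangement. -/
def normal4 : Fin 4 → Site := ![![1, 1, 1], ![1, 1, -1], ![1, -1, 1], ![-1, 1, 1]]

/-- `H`-representation (in `x = (√2)⁻¹ y` coordinates) of the chamber with label `(k, m)`:
`k_i < y_i < k_i + 1` (`i < 3`) and `2 m_j < ⟪normal4 j, y⟫ < 2 m_j + 2` (`j < 4`). -/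
def chamberH (k : Fin 3 → ℤ) (m : Fin 4 → ℤ) : Finset (EuclideanSpace ℝ (Fin 3) × ℝ) :=
  (univ : Finset (Fin 3)).image (fun i => (Real.sqrt 2 • EuclideanSpace.single i (1 : ℝ), (k i : ℝ) + 1)) ∪
  (univ : Finset (Fin 3)).image (fun i => (-(Real.sqrt 2 • EuclideanSpace.single i (1 : ℝ)), -(k i : ℝ))) ∪
  (univ : Finset (Fin 4)).image (fun j => (Real.sqrt 2 • intVec (normal4 j), 2 * (m j : ℝ) + 2)) ∪
  (univ : Finset (Fin 4)).image (fun j => (-(Real.sqrt 2 • intVec (normal4 j)), -(2 * (m j : ℝ))))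

/-- The open chamber (cell) with label `(k, m)`. -/
def cellOf (k : Fin 3 → ℤ) (m : Fin 4 → ℤ) : Set (EuclideanSpace ℝ (Fin 3)) := ⋂ q ∈ chamberH k m, {x : EuclideanSpace ℝ (Fin 3) | ⟪q.1, x⟫ < q.2}

/-- The closed chamber with label `(k, m)`: the fourteen NON-strict inequalities (it contains the closure of
`cellOf k m`, with equality when the cell is nonempty). -/
def closedChamber (k : Fin 3 → ℤ) (m : Fin 4 → ℤ) : Set (EuclideanSpace ℝ (Fin 3)) :=
  {x : EuclideanSpace ℝ (Fin 3) | (∀ i : Fin 3, (k i : ℝ) ≤ Real.sqrt 2 * x i ∧ Real.sqrt 2 * x i ≤ k i + 1) ∧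
    ∀ j : Fin 4, 2 * (m j : ℝ) ≤ ⟪intVec (normal4 j), Real.sqrt 2 • x⟫ ∧
      ⟪intVec (normal4 j), Real.sqrt 2 • x⟫ ≤ 2 * m j + 2}

/-- Label of the up-tetrahedron `T⁺(p)`. -/
def labelUp (p : Site) : (Fin 3 → ℤ) × (Fin 4 → ℤ) :=
  (fccPoint p, ![p 0 + p 1 + p 2, p 0, p 1, p 2])

/-- Label of the down-tetrahedron `T⁻(p)`. -/
def labelDn (p : Site) : (Fin 3 → ℤ) × (Fin 4 → ℤ) :=
  (fccPoint p - ![1, 1, 1], ![p 0 + p 1 + p 2 - 1, p 0 - 1, p 1 - 1, p 2 - 1])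

/-- Label of the corner tetrahedron of `O(p)` pointing in the directions `s` (apex `holeZ p`, vertex on axis
`a` at `holeZ p ± e_a`). -/
def labelCorner (p : Site) (s : Fin 3 → Bool) : (Fin 3 → ℤ) × (Fin 4 → ℤ) :=
  (fun a => holeZ p a - (if s a then 0 else 1), ![p 0 + p 1 + p 2, p 0, p 1, p 2 - 1])

end Summit.Ventures.Crystal3D.TentCertificate

end
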